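import Mathlib.Topology.Algebra.Ring.Basic
import Mathlib.Topology.Algebra.Group.Basic
import Mathlib.Topology.Algebra.ContinuousMonoidHom
import Mathlib.Topology.Instances.Matrix
import Mathlib.LinearAlgebra.Matrix.Charpoly.Coeff
import Mathlib.LinearAlgebra.Matrix.GeneralLinearGroup.Defs
import Mathlib.LinearAlgebra.Matrix.NonsingularInverse
import Literature.RepresentationTheory.Semisimple.FinTwoSemisimplification
import HarnessLib

/-!
# Descent of an odd two-dimensional representation to the field of its traces

Let `j : F → E` be an embedding of fields of characteristic `≠ 2`, `G` a group and
`φ : G → GL₂(E)` a representation all of whose traces lie in `j(F)`. In general `φ` need not be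
realisable over `F` (the obstruction is a quaternion algebra over `F`, i.e. a Schur index). It
IS realisable — up to semisimplification, i.e. with the same characteristic polynomials — as soon
as the image of `φ` contains an **odd involution**: an element `φ(c)`, `c² = 1`, with
`det φ(c) = -1` (eigenvalues `1` and `-1`, rational and distinct). This is the remark by which
Deligne–Serre (*Formes modulaires de poids 1*, 1974, footnote (2), p. 521: *"la représentation `ρ`
du théorème 4.1 est réalisable sur `K` : son image contient un élément à valeurs propres
rationnelles et distinctes (l'élément `ρ(c)` de 4.5) et cela entraîne que son indice de Schur
est 1"*) descend the Galois representations attached to modular forms, `c` being a complex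
conjugation; the same argument descends Deligne's `λ`-adic representations from `ℚ̄_ℓ` (or from
any extension of the coefficient field) to the completion `K_λ` of any number field `K` containing
the Hecke eigenvalues (Ribet 1977, §2; Darmon–Diamond–Taylor 1995, proof of Thm. 3.1).

We prove it here in the elementary `2 × 2` form needed for that application, for a continuous
`φ` on a topological group and a topological embedding `j` (take discrete topologies for the bare
algebraic statement):

* `Literature.RepresentationTheory.Semisimple.exists_continuous_descent_fin_two_of_det_eq_neg_one`
  — there is a continuous `ρ : G → GL₂(F)` whose representation on `F²` is **semisimple**, with
  `det(X - ρ(g)) ↦ det(X - φ(g))` under `j` for every `g`, and `ρ(g) = 1` whenever `φ(g) = 1`.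

Proof (classical; cf. Ribet 1977, proof of Cor. (2.5), and Serre, *Abelian `ℓ`-adic
representations*, I-2.3 for the trace bookkeeping). Write `t = tr ∘ φ`, so `t(g) ∈ j(F)` and
also `t(gc) ∈ j(F)`.
* If the `φ(g)` have a common eigenvector, with eigencharacter `χ₁` and `χ₂ = det φ / χ₁`, then
  `t(g) = χ₁(g) + χ₂(g)` (Cayley–Hamilton) and, as `χ₁(c) = ±1 = -χ₂(c)`,
  `t(gc) = ±(χ₁(g) - χ₂(g))`; hence `χᵢ(g) ∈ j(F)` and `ρ = diag(χ₁, χ₂)` (pulled back to `F`)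
  works — it is semisimple, being diagonal.
* Otherwise conjugate so that `φ(c) = diag(1, -1)` and write `φ(g) = (a b; c' d)`: then
  `a + d = t(g)` and `a - d = t(gc)` lie in `j(F)`, so do `a`, `d`, and `b(g) c'(h) =
  a(gh) - a(g) a(h)`. Irreducibility gives `b(h₀) ≠ 0 ≠ c'(g₀)`; after the further conjugation by
  `diag(1, b(h₀))` all entries lie in `j(F)`, and the pulled-back `ρ : G → GL₂(F)` is irreducible
  (a stable `F`-line would span a stable `E`-line), hence semisimple.

No named facts; everything is proved.

## References

* P. Deligne, J.-P. Serre, *Formes modulaires de poids 1*, Ann. Sci. ÉNS (4) 7 (1974), 507–530,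
  footnote (2) p. 521 (with Rem. 4.5). [DeligneSerreASENS1974]
* K. A. Ribet, *Galois representations attached to eigenforms with Nebentypus*, LNM 601 (1977),
  §2. [Ribet1977Nebentypus]
* J.-P. Serre, *Abelian `ℓ`-adic representations and elliptic curves* (1968), Ch. I §2.3.
-/

noncomputable section

open scoped MatrixGroups

open Matrix Polynomial Module Topology

namespace Literature.RepresentationTheory.Semisimple

universe u v w

variable {G : Type u} [Group G] {E : Type v} [Field E] {F : Type w} [Field F] (j : F →+* E)

/-! ### Lifting homomorphisms along an embedding of fields -/

section Lift

/-- A character `f : G → Eˣ` with values in `j(F)` is `j ∘ f'` for a (unique) character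
`f' : G → Fˣ`. [folklore] -/
theorem exists_unitsHom_lift (f : G →* Eˣ) (hf : ∀ g, ((f g : Eˣ) : E) ∈ Set.range j) :
    ∃ f' : G →* Fˣ, ∀ g, j ((f' g : Fˣ) : F) = f g := by
  choose x hx using hf
  have hx0 : ∀ g, x g ≠ 0 := fun g h ↦ (f g).ne_zero (by rw [← hx g, h, map_zero])
  have hone : x 1 = 1 := j.injective (by rw [hx, map_one, Units.val_one, map_one])
  have hmul : ∀ g h, x (g * h) = x g * x h := fun g h ↦
    j.injective (by rw [hx, map_mul, Units.val_mul, map_mul, hx, hx])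
  exact ⟨{ toFun := fun g ↦ Units.mk0 (x g) (hx0 g)
           map_one' := Units.ext hone
           map_mul' := fun g h ↦ Units.ext (hmul g h) }, fun g ↦ hx g⟩

variable {n : Type*} [Fintype n] [DecidableEq n]

/-- A matrix representation `ψ : G → GL_n(E)` all of whose matrix entries lie in `j(F)` is the
base change along `j` of a (unique) `ρ : G → GL_n(F)`. [folklore] -/
theorem exists_glHom_lift (ψ : G →* GL n E)
    (hψ : ∀ g i k, ((ψ g : GL n E) : Matrix n n E) i k ∈ Set.range j) :
    ∃ ρ : G →* GL n F, ∀ g, (((ρ g : GL n F) : Matrix n n F)).map j = (ψ g : Matrix n n E) := by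
  choose x hx using hψ
  let B : G → Matrix n n F := fun g ↦ Matrix.of fun i k ↦ x g i k
  have hB : ∀ g, (B g).map j = (ψ g : Matrix n n E) := fun g ↦ by
    ext i k
    simp [B, hx]
  have hinj : Function.Injective fun M : Matrix n n F ↦ M.map j :=
    fun M N h ↦ Matrix.ext fun i k ↦ j.injective (by simpa using congr_fun (congr_fun h i) k)
  have hone : B 1 = 1 := hinj (by
    change (B 1).map j = (1 : Matrix n n F).map j
    rw [hB, map_one, Units.val_one, Matrix.map_one _ (map_zero j) (map_one j)])
  have hmul : ∀ g h, B (g * h) = B g * B h := fun g h ↦ hinj (by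
    change (B (g * h)).map j = (B g * B h).map j
    rw [hB, map_mul, Units.val_mul, Matrix.map_mul, hB, hB])
  refine ⟨{ toFun := fun g ↦ ⟨B g, B g⁻¹, by rw [← hmul, mul_inv_cancel, hone],
              by rw [← hmul, inv_mul_cancel, hone]⟩
            map_one' := Units.ext hone
            map_mul' := fun g h ↦ Units.ext (hmul g h) }, fun g ↦ hB g⟩

end Lift

/-! ### Continuity of matrix-valued homomorphisms -/

section Continuity

variable [TopologicalSpace G] [IsTopologicalGroup G] [TopologicalSpace F]
  {n : Type*} [Fintype n] [DecidableEq n]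

/-- A homomorphism `ρ : G → GL_n(F)` on a topological group is continuous as soon as
`g ↦ ρ(g)` is continuous as a matrix-valued map (the inverse `ρ(g)⁻¹ = ρ(g⁻¹)` is then
continuous too). This is Mathlib's `Continuous.of_coeHom_comp` (a units-valued hom is continuous
iff its coercion is); the proofs below use the Mathlib lemma directly. The former `GL n F`-typed
restatement under this name had no users and was flagged three times by the duplicate probe
(librarian dedup-01786, dedup-02380, dedup-02646), so the name is now a deprecated alias of the
Mathlib lemma itself. [folklore] -/
@[deprecated Continuous.of_coeHom_comp (since := "2026-08-16")]
alias continuous_glHom_of_continuous_val := Continuous.of_coeHom_comp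

end Continuity

/-! ### The reducible case: a common eigenvector -/

section Reducible

variable [TopologicalSpace G] [IsTopologicalGroup G] [TopologicalSpace E] [IsTopologicalRing E]
  [TopologicalSpace F]

/-- **Descent, reducible case.** Let `φ : G → GL₂(E)` be continuous with traces in `j(F)`
(`j : F → E` a topological embedding of fields, `2 ≠ 0`), let `c ∈ G` with `c² = 1` and
`det φ(c) = -1`, and suppose the `φ(g)` have a common eigenvector `w`, `φ(g) w = χ₁(g) w`. Then
`χ₁` and `χ₂ = det φ / χ₁` take values in `j(F)` (`χ₁ + χ₂ = tr φ`, and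
`tr φ(gc) = χ₁(c) (χ₁(g) - χ₂(g))` with `χ₁(c) = ±1`), and `ρ = diag(χ₁, χ₂)` over `F` is a
continuous semisimple representation with `det(X - ρ(g)) ↦ det(X - φ(g))` and `ρ(g) = 1`
whenever `φ(g) = 1`. [cite: DeligneSerreASENS1974, footnote (2) p. 521] -/
theorem exists_continuous_descent_fin_two_of_common_eigenvector (hj : IsInducing j)
    (φ : G →ₜ* GL (Fin 2) E) (h2 : (2 : E) ≠ 0)
    (htr : ∀ g, ((φ g : GL (Fin 2) E) : Matrix (Fin 2) (Fin 2) E).trace ∈ Set.range j)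
    {c : G} (hc : c * c = 1) (hdet : ((φ c : GL (Fin 2) E) : Matrix (Fin 2) (Fin 2) E).det = -1)
    {w : Fin 2 → E} (hw : w ≠ 0)
    (heig : ∀ g, ∃ t : E, ((φ g : GL (Fin 2) E) : Matrix (Fin 2) (Fin 2) E) *ᵥ w = t • w) :
    ∃ ρ : G →ₜ* GL (Fin 2) F,
      Representation.IsSemisimpleRepresentation
        ((Representation.ofDistribMulAction F (GL (Fin 2) F) (Fin 2 → F)).comp ρ.toMonoidHom) ∧
      (∀ g, (((ρ g : GL (Fin 2) F) : Matrix (Fin 2) (Fin 2) F).map j).charpoly =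
        ((φ g : GL (Fin 2) E) : Matrix (Fin 2) (Fin 2) E).charpoly) ∧
      ∀ g, φ g = 1 → ρ g = 1 := by
  classical
  -- notation: `Φ g` the matrix of `φ g`
  set Φ : G → Matrix (Fin 2) (Fin 2) E := fun g ↦ ((φ g : GL (Fin 2) E) : Matrix (Fin 2) (Fin 2) E)
    with hΦdef
  have hΦmul : ∀ g h, Φ (g * h) = Φ g * Φ h := fun g h ↦ by simp [hΦdef, map_mul]
  have hΦone : Φ 1 = 1 := by simp [hΦdef]
  have hΦcont : Continuous Φ := Units.continuous_val.comp φ.continuous_toFun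
  have h2F : (2 : F) ≠ 0 := fun h ↦ h2 (by rw [← map_ofNat j 2, h, map_zero])
  -- ### the eigencharacter `χ`
  choose χ hχ' using heig
  have hχ : ∀ g, Φ g *ᵥ w = χ g • w := hχ'
  have hχone : χ 1 = 1 := by
    apply smul_left_injective E hw
    change χ 1 • w = (1 : E) • w
    rw [← hχ, hΦone, Matrix.one_mulVec, one_smul]
  have hχmul : ∀ g h, χ (g * h) = χ g * χ h := by
    intro g h
    apply smul_left_injective E hw
    change χ (g * h) • w = (χ g * χ h) • w
    rw [← hχ, hΦmul, ← Matrix.mulVec_mulVec, hχ h, Matrix.mulVec_smul, hχ g, smul_smul, mul_comm]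
  have hχne : ∀ g, χ g ≠ 0 := by
    intro g h0
    have h1 : χ (g⁻¹ * g) = 0 := by rw [hχmul, h0, mul_zero]
    rw [inv_mul_cancel, hχone] at h1
    exact one_ne_zero h1
  have hχinv : ∀ g, χ g⁻¹ = (χ g)⁻¹ := fun g ↦
    eq_inv_of_mul_eq_one_left (by rw [← hχmul, inv_mul_cancel, hχone])
  -- Cayley–Hamilton on the eigenvector: `χ² - tr χ + det = 0`, so `tr = χ + det / χ`
  have hroot : ∀ g, χ g ^ 2 - (Φ g).trace * χ g + (Φ g).det = 0 := fun g ↦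
    sq_sub_trace_mul_add_det_eq_zero hw (hχ g)
  set d : G → E := fun g ↦ (Φ g).det * (χ g)⁻¹ with hddef
  have htrd : ∀ g, (Φ g).trace = χ g + d g := by
    intro g
    have h1 := hroot g
    have hinv : χ g * (χ g)⁻¹ = 1 := mul_inv_cancel₀ (hχne g)
    simp only [hddef]
    linear_combination -(χ g)⁻¹ * h1 + (χ g - (Φ g).trace) * hinv
  -- ### the involution: `χ c = ±1`, `d c = -χ c`, `tr φ(gc) = χ c (χ g - d g)`
  have hχc : χ c * χ c = 1 := by rw [← hχmul, hc, hχone]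
  have hχc' : (χ c)⁻¹ = χ c := inv_eq_of_mul_eq_one_left hχc
  have hdetmul : ∀ g h, (Φ (g * h)).det = (Φ g).det * (Φ h).det := fun g h ↦ by
    rw [hΦmul, Matrix.det_mul]
  have htrc : ∀ g, (Φ (g * c)).trace = χ c * (χ g - d g) := by
    intro g
    rw [htrd, hddef]
    simp only
    rw [hdetmul, hdet, hχmul, mul_inv, hχc']
    ring
  -- ### values in the subfield `R = j(F)`
  set R : Subfield E := j.fieldRange with hRdef
  have hmemR : ∀ {x : E}, x ∈ R ↔ x ∈ Set.range j := fun {x} ↦ by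
    simp [hRdef, RingHom.mem_fieldRange]
  have htrR : ∀ g, (Φ g).trace ∈ R := fun g ↦ hmemR.mpr (htr g)
  have hχcR : χ c ∈ R := by
    rcases mul_self_eq_one_iff.mp hχc with h | h
    · rw [h]; exact one_mem R
    · rw [h]; exact neg_mem (one_mem R)
  have h2R : (2 : E)⁻¹ ∈ R := inv_mem (by exact_mod_cast natCast_mem R 2)
  have hχR : ∀ g, χ g ∈ R := by
    intro g
    have hsum : χ g + d g ∈ R := htrd g ▸ htrR g
    have hdiff : χ g - d g ∈ R := by
      have h1 : χ c * (Φ (g * c)).trace ∈ R := mul_mem hχcR (htrR _)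
      rw [htrc, ← mul_assoc, hχc, one_mul] at h1
      exact h1
    have h3 : χ g = (2 : E)⁻¹ * ((χ g + d g) + (χ g - d g)) := by
      field_simp
      ring
    rw [h3]
    exact mul_mem h2R (add_mem hsum hdiff)
  have hdR : ∀ g, d g ∈ R := fun g ↦ by
    have h1 : d g = (Φ g).trace - χ g := by rw [htrd]; ring
    rw [h1]
    exact sub_mem (htrR g) (hχR g)
  -- ### the characters `χ₁ = χ`, `χ₂ = d`, lifted to `F`
  let χ₁ : G →* Eˣ :=
    { toFun := fun g ↦ Units.mk0 (χ g) (hχne g)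
      map_one' := Units.ext hχone
      map_mul' := fun g h ↦ Units.ext (hχmul g h) }
  have hχ₁ : ∀ g, ((χ₁ g : Eˣ) : E) = χ g := fun _ ↦ rfl
  let δ : G →* Eˣ := Matrix.GeneralLinearGroup.det.comp φ.toMonoidHom
  have hδ : ∀ g, ((δ g : Eˣ) : E) = (Φ g).det := fun _ ↦ rfl
  let χ₂ : G →* Eˣ := δ * χ₁⁻¹
  have hχ₂ : ∀ g, ((χ₂ g : Eˣ) : E) = d g := fun g ↦ by simp [χ₂, hδ, hχ₁, hddef]
  obtain ⟨ψ₁, hψ₁⟩ := exists_unitsHom_lift j χ₁ fun g ↦ hmemR.mp (by rw [hχ₁]; exact hχR g)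
  obtain ⟨ψ₂, hψ₂⟩ := exists_unitsHom_lift j χ₂ fun g ↦ hmemR.mp (by rw [hχ₂]; exact hdR g)
  simp only [hχ₁] at hψ₁
  simp only [hχ₂] at hψ₂
  -- ### `ρ₀ = diag(ψ₁, ψ₂)`
  obtain ⟨D, hD⟩ := exists_diagonalHom (k := F)
  let ρ₀ : G →* GL (Fin 2) F := D.comp (ψ₁.prod ψ₂)
  have hρ₀ : ∀ g, ((ρ₀ g : GL (Fin 2) F) : Matrix (Fin 2) (Fin 2) F) =
      Matrix.diagonal ![((ψ₁ g : Fˣ) : F), ((ψ₂ g : Fˣ) : F)] := fun g ↦ hD (ψ₁ g, ψ₂ g)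
  -- ### continuity
  have hχcont : Continuous χ := by
    obtain ⟨i, hi⟩ : ∃ i, w i ≠ 0 := by
      by_contra h
      push Not at h
      exact hw (funext h)
    have h1 : ∀ g, χ g = (Φ g *ᵥ w) i * (w i)⁻¹ := fun g ↦ by
      rw [hχ g, Pi.smul_apply, smul_eq_mul, mul_assoc, mul_inv_cancel₀ hi, mul_one]
    have h2 : Continuous fun g ↦ (Φ g *ᵥ w) i :=
      (continuous_apply i).comp (hΦcont.matrix_mulVec continuous_const)
    rw [show χ = fun g ↦ (Φ g *ᵥ w) i * (w i)⁻¹ from funext h1]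
    exact h2.mul continuous_const
  have hdcont : Continuous d := by
    have h1 : ∀ g, d g = (Φ g).det * χ g⁻¹ := fun g ↦ by rw [hddef, hχinv]
    rw [show d = fun g ↦ (Φ g).det * χ g⁻¹ from funext h1]
    exact hΦcont.matrix_det.mul (hχcont.comp continuous_inv)
  have hψ₁cont : Continuous fun g ↦ ((ψ₁ g : Fˣ) : F) := by
    rw [hj.continuous_iff]
    simpa only [Function.comp_def, hψ₁] using hχcont
  have hψ₂cont : Continuous fun g ↦ ((ψ₂ g : Fˣ) : F) := by
    rw [hj.continuous_iff]
    simpa only [Function.comp_def, hψ₂] using hdcont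
  have hρ₀cont : Continuous ρ₀ := by
    refine Continuous.of_coeHom_comp ?_
    show Continuous fun g ↦ ((ρ₀ g : GL (Fin 2) F) : Matrix (Fin 2) (Fin 2) F)
    simp only [hρ₀]
    refine Continuous.matrix_diagonal (continuous_pi fun i ↦ ?_)
    fin_cases i
    · simpa using hψ₁cont
    · simpa using hψ₂cont
  -- ### conclusion
  refine ⟨⟨ρ₀, hρ₀cont⟩, ?_, fun g ↦ ?_, fun g hg ↦ ?_⟩
  · exact isSemisimpleRepresentation_diagonal_fin_two ρ₀ fun g ↦ ⟨_, hρ₀ g⟩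
  · -- same characteristic polynomial: compare trace and determinant
    change (((ρ₀ g : GL (Fin 2) F) : Matrix (Fin 2) (Fin 2) F).map j).charpoly = (Φ g).charpoly
    rw [hρ₀, Matrix.diagonal_map (map_zero j), Matrix.charpoly_fin_two, Matrix.charpoly_fin_two]
    have hdiag : (fun m ↦ j (![((ψ₁ g : Fˣ) : F), ((ψ₂ g : Fˣ) : F)] m)) = ![χ g, d g] := by
      funext m
      fin_cases m
      · simp [hψ₁]
      · simp [hψ₂]
    rw [hdiag]
    have ht : (Matrix.diagonal ![χ g, d g]).trace = (Φ g).trace := by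
      rw [Matrix.trace_fin_two, htrd]
      simp
    have hd' : (Matrix.diagonal ![χ g, d g]).det = (Φ g).det := by
      rw [Matrix.det_diagonal, Fin.prod_univ_two]
      simp only [Matrix.cons_val_zero, Matrix.cons_val_one, hddef]
      rw [mul_comm (Φ g).det, ← mul_assoc, mul_inv_cancel₀ (hχne g), one_mul]
    rw [ht, hd']
  · -- kernel
    have hΦg : Φ g = 1 := by simp [hΦdef, hg]
    have hχg : χ g = 1 := by
      apply smul_left_injective E hw
      change χ g • w = (1 : E) • w
      rw [← hχ, hΦg, Matrix.one_mulVec, one_smul]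
    have h1 : ψ₁ g = 1 := Units.ext (j.injective (by rw [hψ₁, hχg, Units.val_one, map_one]))
    have h2' : ψ₂ g = 1 := Units.ext (j.injective (by
      rw [hψ₂, Units.val_one, map_one, hddef]
      simp [hΦg, hχg]))
    change ρ₀ g = 1
    change D ((ψ₁.prod ψ₂) g) = 1
    rw [MonoidHom.prod_apply, h1, h2', show ((1 : Fˣ), (1 : Fˣ)) = 1 from rfl, map_one]

end Reducible

/-! ### Common eigenvectors and conjugation -/

section Conj

variable {n : Type*} [Fintype n] [DecidableEq n]

omit [Group G] in
/-- If `v ≠ 0` is a common eigenvector of the conjugates `V Φ(g) V⁻¹`, then `V⁻¹ v ≠ 0` is a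
common eigenvector of the `Φ(g)`. [folklore] -/
theorem common_eigenvector_of_conj (Φ : G → Matrix n n E) (V : GL n E) {v : n → E} (hv : v ≠ 0)
    (h : ∀ g, ∃ t : E,
      (((V : GL n E) : Matrix n n E) * Φ g * ((V⁻¹ : GL n E) : Matrix n n E)) *ᵥ v = t • v) :
    ((V⁻¹ : GL n E) : Matrix n n E) *ᵥ v ≠ 0 ∧
      ∀ g, ∃ t : E, Φ g *ᵥ (((V⁻¹ : GL n E) : Matrix n n E) *ᵥ v) =
        t • (((V⁻¹ : GL n E) : Matrix n n E) *ᵥ v) := by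
  have hVV : ((V : GL n E) : Matrix n n E) * ((V⁻¹ : GL n E) : Matrix n n E) = 1 := by
    rw [← Units.val_mul, mul_inv_cancel, Units.val_one]
  have hVV' : ((V⁻¹ : GL n E) : Matrix n n E) * ((V : GL n E) : Matrix n n E) = 1 := by
    rw [← Units.val_mul, inv_mul_cancel, Units.val_one]
  refine ⟨fun h0 ↦ hv ?_, fun g ↦ ?_⟩
  · have h1 : v = ((V : GL n E) : Matrix n n E) *ᵥ (((V⁻¹ : GL n E) : Matrix n n E) *ᵥ v) := by
      rw [Matrix.mulVec_mulVec, hVV, Matrix.one_mulVec]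
    rw [h1, h0, Matrix.mulVec_zero]
  · obtain ⟨t, ht⟩ := h g
    refine ⟨t, ?_⟩
    calc Φ g *ᵥ (((V⁻¹ : GL n E) : Matrix n n E) *ᵥ v)
        = (Φ g * ((V⁻¹ : GL n E) : Matrix n n E)) *ᵥ v := by rw [Matrix.mulVec_mulVec]
      _ = (((V⁻¹ : GL n E) : Matrix n n E) *
            ((((V : GL n E) : Matrix n n E) * Φ g * ((V⁻¹ : GL n E) : Matrix n n E)))) *ᵥ v := by
          rw [← mul_assoc, ← mul_assoc, hVV', one_mul]
      _ = ((V⁻¹ : GL n E) : Matrix n n E) *ᵥ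
            (((((V : GL n E) : Matrix n n E) * Φ g * ((V⁻¹ : GL n E) : Matrix n n E))) *ᵥ v) := by
          rw [← Matrix.mulVec_mulVec]
      _ = ((V⁻¹ : GL n E) : Matrix n n E) *ᵥ (t • v) := by rw [ht]
      _ = t • (((V⁻¹ : GL n E) : Matrix n n E) *ᵥ v) := Matrix.mulVec_smul _ _ _

end Conj

/-! ### The irreducible case: no common eigenvector -/

section Irreducible

variable [TopologicalSpace G] [IsTopologicalGroup G] [TopologicalSpace E] [IsTopologicalRing E]
  [TopologicalSpace F]

/-- **Descent, irreducible case.** Let `φ : G → GL₂(E)` be continuous with traces in `j(F)`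
(`j : F → E` a topological embedding of fields, `2 ≠ 0`), let `c ∈ G` with `c² = 1` and
`det φ(c) = -1`, and suppose the `φ(g)` have NO common eigenvector. In a basis with
`φ(c) = diag(1, -1)` write `φ(g) = (a b; c' d)`: `a ± d = tr φ(g), tr φ(gc)` lie in `j(F)`, hence
so do `a`, `d` and `b(g) c'(h) = a(gh) - a(g) a(h)`; as `b(h₀) ≠ 0 ≠ c'(g₀)` for some `g₀, h₀`,
conjugating further by `diag(1, b(h₀))` puts every entry in `j(F)`, and the pulled-back
`ρ : G → GL₂(F)` is continuous, irreducible (hence semisimple), with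
`det(X - ρ(g)) ↦ det(X - φ(g))` and `ρ(g) = 1` whenever `φ(g) = 1`.
[cite: DeligneSerreASENS1974, footnote (2) p. 521] -/
theorem exists_continuous_descent_fin_two_of_no_common_eigenvector (hj : IsInducing j)
    (φ : G →ₜ* GL (Fin 2) E) (h2 : (2 : E) ≠ 0)
    (htr : ∀ g, ((φ g : GL (Fin 2) E) : Matrix (Fin 2) (Fin 2) E).trace ∈ Set.range j)
    {c : G} (hc : c * c = 1) (hdet : ((φ c : GL (Fin 2) E) : Matrix (Fin 2) (Fin 2) E).det = -1)
    (hno : ∀ w : Fin 2 → E, w ≠ 0 →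
      (∀ g, ∃ t : E, ((φ g : GL (Fin 2) E) : Matrix (Fin 2) (Fin 2) E) *ᵥ w = t • w) → False) :
    ∃ ρ : G →ₜ* GL (Fin 2) F,
      Representation.IsSemisimpleRepresentation
        ((Representation.ofDistribMulAction F (GL (Fin 2) F) (Fin 2 → F)).comp ρ.toMonoidHom) ∧
      (∀ g, (((ρ g : GL (Fin 2) F) : Matrix (Fin 2) (Fin 2) F).map j).charpoly =
        ((φ g : GL (Fin 2) E) : Matrix (Fin 2) (Fin 2) E).charpoly) ∧
      ∀ g, φ g = 1 → ρ g = 1 := by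
  classical
  -- notation: `Φ g` the matrix of `φ g`
  set Φ : G → Matrix (Fin 2) (Fin 2) E := fun g ↦ ((φ g : GL (Fin 2) E) : Matrix (Fin 2) (Fin 2) E)
    with hΦdef
  have hΦmul : ∀ g h, Φ (g * h) = Φ g * Φ h := fun g h ↦ by simp [hΦdef, map_mul]
  have hΦone : Φ 1 = 1 := by simp [hΦdef]
  have hΦcont : Continuous Φ := Units.continuous_val.comp φ.continuous_toFun
  have hno' : ∀ w : Fin 2 → E, w ≠ 0 → (∀ g, ∃ t : E, Φ g *ᵥ w = t • w) → False := hno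
  have htr' : ∀ g, (Φ g).trace ∈ Set.range j := htr
  have hdet' : (Φ c).det = -1 := hdet
  -- ### the involution `M = Φ c` and its eigenvectors `wp` (for `1`) and `wm` (for `-1`)
  have hMM : Φ c * Φ c = 1 := by rw [← hΦmul, hc, hΦone]
  have hMMv : ∀ u, Φ c *ᵥ (Φ c *ᵥ u) = u := fun u ↦ by
    rw [Matrix.mulVec_mulVec, hMM, Matrix.one_mulVec]
  obtain ⟨u, hu⟩ : ∃ u, Φ c *ᵥ u ≠ u := by
    by_contra h
    push Not at h
    have hM1 : Φ c = 1 := by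
      ext i k
      have h1 := congr_fun (h (Pi.single k 1)) i
      rw [Matrix.mulVec_single_one] at h1
      change Φ c i k = _ at h1
      rw [h1, Matrix.one_apply, Pi.single_apply]
    have h3 : (Φ c).det = 1 := by rw [hM1, Matrix.det_one]
    rw [hdet'] at h3
    exact h2 (by linear_combination -h3)
  obtain ⟨u', hu'⟩ : ∃ u', Φ c *ᵥ u' ≠ -u' := by
    by_contra h
    push Not at h
    have hM1 : Φ c = -1 := by
      ext i k
      have h1 := congr_fun (h (Pi.single k 1)) i
      rw [Matrix.mulVec_single_one] at h1
      change Φ c i k = _ at h1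
      rw [h1, Pi.neg_apply, Matrix.neg_apply, Matrix.one_apply, Pi.single_apply]
    have h3 : (Φ c).det = 1 := by
      rw [hM1, Matrix.det_neg, Matrix.det_one, Fintype.card_fin]
      norm_num
    rw [hdet'] at h3
    exact h2 (by linear_combination -h3)
  set wm : Fin 2 → E := Φ c *ᵥ u - u with hwmdef
  have hwm0 : wm ≠ 0 := sub_ne_zero.mpr hu
  have hwm : Φ c *ᵥ wm = -wm := by
    rw [hwmdef, Matrix.mulVec_sub, hMMv, neg_sub]
  set wp : Fin 2 → E := Φ c *ᵥ u' + u' with hwpdef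
  have hwp0 : wp ≠ 0 := fun h ↦ hu' (eq_neg_of_add_eq_zero_left h)
  have hwp : Φ c *ᵥ wp = wp := by
    rw [hwpdef, Matrix.mulVec_add, hMMv, add_comm]
  -- ### the basis change `P = (wp | wm)`: `Φ c P = P diag(1, -1)`
  have hli : LinearIndependent E ![wp, wm] := by
    rw [LinearIndependent.pair_iff]
    intro s t hst
    have h1 : s • wp - t • wm = 0 := by
      have h0 := congrArg (fun x ↦ Φ c *ᵥ x) hst
      simp only [Matrix.mulVec_add, Matrix.mulVec_smul, hwp, hwm, Matrix.mulVec_zero,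
        smul_neg] at h0
      rwa [← sub_eq_add_neg] at h0
    have h3 : (2 * s) • wp = (s • wp + t • wm) + (s • wp - t • wm) := by
      rw [mul_smul, two_smul]; abel
    rw [hst, h1, add_zero] at h3
    have hs : s = 0 := by
      rcases smul_eq_zero.mp h3 with h | h
      · exact (mul_eq_zero.mp h).resolve_left h2
      · exact absurd h hwp0
    rw [hs, zero_smul, zero_add] at hst
    exact ⟨hs, (smul_eq_zero.mp hst).resolve_right hwm0⟩
  let P : Matrix (Fin 2) (Fin 2) E := Matrix.of fun i k ↦ ![wp, wm] k i
  have hPcol : P.col = ![wp, wm] := by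
    funext k i
    rfl
  have hPunit : IsUnit P := Matrix.linearIndependent_cols_iff_isUnit.mp (by rw [hPcol]; exact hli)
  set Pu : GL (Fin 2) E := hPunit.unit with hPudef
  have hPu : ((Pu : GL (Fin 2) E) : Matrix (Fin 2) (Fin 2) E) = P := hPunit.unit_spec
  set D : Matrix (Fin 2) (Fin 2) E := Matrix.diagonal ![1, -1] with hDdef
  have hMP : Φ c * P = P * D := by
    ext i k
    have hL : (Φ c * P) i k = (Φ c *ᵥ fun l ↦ P l k) i := rfl
    rw [hL, hDdef, Matrix.mul_diagonal]
    fin_cases k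
    · simp [hwp, P]
    · simp [hwm, P]
  have hPP : ((Pu⁻¹ : GL (Fin 2) E) : Matrix (Fin 2) (Fin 2) E) * P = 1 := by
    rw [← hPu, ← Units.val_mul, inv_mul_cancel, Units.val_one]
  have hPP' : P * ((Pu⁻¹ : GL (Fin 2) E) : Matrix (Fin 2) (Fin 2) E) = 1 := by
    rw [← hPu, ← Units.val_mul, mul_inv_cancel, Units.val_one]
  -- ### the conjugate `A g = P⁻¹ Φ(g) P`, with `A c = diag(1, -1)`
  set A : G → Matrix (Fin 2) (Fin 2) E :=
    fun g ↦ ((Pu⁻¹ : GL (Fin 2) E) : Matrix (Fin 2) (Fin 2) E) * Φ g * P with hAdef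
  have hAc : A c = D := by
    simp only [hAdef]
    rw [mul_assoc, hMP, ← mul_assoc, hPP, one_mul]
  have hAmul : ∀ g h, A (g * h) = A g * A h := by
    intro g h
    simp only [hAdef]
    rw [hΦmul]
    calc ((Pu⁻¹ : GL (Fin 2) E) : Matrix (Fin 2) (Fin 2) E) * (Φ g * Φ h) * P
        = ((Pu⁻¹ : GL (Fin 2) E) : Matrix (Fin 2) (Fin 2) E) * Φ g *
            (P * ((Pu⁻¹ : GL (Fin 2) E) : Matrix (Fin 2) (Fin 2) E)) * Φ h * P := by
          rw [hPP']; simp only [mul_one, mul_assoc]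
      _ = _ := by simp only [mul_assoc]
  have htrA : ∀ g, (A g).trace = (Φ g).trace := by
    intro g
    simp only [hAdef]
    rw [← hPu, Matrix.trace_units_conj']
  -- entries
  set a : G → E := fun g ↦ A g 0 0 with hadef
  set b : G → E := fun g ↦ A g 0 1 with hbdef
  set c' : G → E := fun g ↦ A g 1 0 with hc'def
  set d : G → E := fun g ↦ A g 1 1 with hddef
  have htr_ad : ∀ g, (Φ g).trace = a g + d g := fun g ↦ by
    rw [← htrA, Matrix.trace_fin_two]
  have htr_gc : ∀ g, (Φ (g * c)).trace = a g - d g := by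
    intro g
    rw [← htrA, hAmul, hAc, Matrix.trace_fin_two, hDdef, Matrix.mul_diagonal, Matrix.mul_diagonal]
    simp [hadef, hddef]
    ring
  have hprod : ∀ g h, a (g * h) = a g * a h + b g * c' h := by
    intro g h
    simp only [hadef, hbdef, hc'def]
    rw [hAmul, Matrix.mul_apply, Fin.sum_univ_two]
  -- ### values in the subfield `R = j(F)`
  set R : Subfield E := j.fieldRange with hRdef
  have hmemR : ∀ {x : E}, x ∈ R ↔ x ∈ Set.range j := fun {x} ↦ by
    simp [hRdef, RingHom.mem_fieldRange]
  have htrR : ∀ g, (Φ g).trace ∈ R := fun g ↦ hmemR.mpr (htr' g)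
  have h2R : (2 : E)⁻¹ ∈ R := inv_mem (by exact_mod_cast natCast_mem R 2)
  have haR : ∀ g, a g ∈ R := by
    intro g
    have h3 : a g = (2 : E)⁻¹ * ((a g + d g) + (a g - d g)) := by
      field_simp
      ring
    rw [h3]
    exact mul_mem h2R (add_mem (htr_ad g ▸ htrR g) (htr_gc g ▸ htrR (g * c)))
  have hdR : ∀ g, d g ∈ R := fun g ↦ by
    have h1 : d g = (a g + d g) - a g := by ring
    rw [h1]
    exact sub_mem (htr_ad g ▸ htrR g) (haR g)
  have hbcR : ∀ g h, b g * c' h ∈ R := fun g h ↦ by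
    have h1 : b g * c' h = a (g * h) - a g * a h := by rw [hprod]; ring
    rw [h1]
    exact sub_mem (haR _) (mul_mem (haR g) (haR h))
  -- ### irreducibility: some `c'(g₀) ≠ 0` and some `b(h₀) ≠ 0`
  have hAconj : ∀ g, A g = ((Pu⁻¹ : GL (Fin 2) E) : Matrix (Fin 2) (Fin 2) E) * Φ g *
      (((Pu⁻¹)⁻¹ : GL (Fin 2) E) : Matrix (Fin 2) (Fin 2) E) := fun g ↦ by
    rw [inv_inv, hPu]
  obtain ⟨g₀, hg₀⟩ : ∃ g₀, c' g₀ ≠ 0 := by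
    by_contra h
    push Not at h
    refine (common_eigenvector_of_conj Φ Pu⁻¹ (v := Pi.single 0 1) (by simp) fun g ↦ ⟨a g, ?_⟩).elim
      fun h0 h1 ↦ hno' _ h0 h1
    rw [← hAconj, Matrix.mulVec_single_one]
    ext i
    fin_cases i
    · simp [hadef]
    · simpa [hc'def] using h g
  obtain ⟨h₀, hh₀⟩ : ∃ h₀, b h₀ ≠ 0 := by
    by_contra h
    push Not at h
    refine (common_eigenvector_of_conj Φ Pu⁻¹ (v := Pi.single 1 1) (by simp) fun g ↦ ⟨d g, ?_⟩).elim
      fun h0 h1 ↦ hno' _ h0 h1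
    rw [← hAconj, Matrix.mulVec_single_one]
    ext i
    fin_cases i
    · simpa [hbdef] using h g
    · simp [hddef]
  -- ### the rescaling `Q = diag(1, β)`, `β = b(h₀)`
  set β : E := b h₀ with hβdef
  have hβ : β ≠ 0 := hh₀
  let Qm : Matrix (Fin 2) (Fin 2) E := Matrix.diagonal ![1, β]
  let Qi : Matrix (Fin 2) (Fin 2) E := Matrix.diagonal ![1, β⁻¹]
  have hQ1 : Qm * Qi = 1 := by
    simp only [Qm, Qi, Matrix.diagonal_mul_diagonal, ← Matrix.diagonal_one]
    congr 1
    funext i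
    fin_cases i
    · simp
    · simp [hβ]
  have hQ2 : Qi * Qm = 1 := by
    simp only [Qm, Qi, Matrix.diagonal_mul_diagonal, ← Matrix.diagonal_one]
    congr 1
    funext i
    fin_cases i
    · simp
    · simp [hβ]
  let Q : GL (Fin 2) E := ⟨Qm, Qi, hQ1, hQ2⟩
  -- ### the conjugate `ψ = U φ U⁻¹`, `U = Q P⁻¹`, has entries in `R`
  set U : GL (Fin 2) E := Q * Pu⁻¹ with hUdef
  let ψ : G →* GL (Fin 2) E := (MulAut.conj U).toMonoidHom.comp φ.toMonoidHom
  have hψ : ∀ g, ((ψ g : GL (Fin 2) E) : Matrix (Fin 2) (Fin 2) E) =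
      ((U : GL (Fin 2) E) : Matrix (Fin 2) (Fin 2) E) * Φ g *
        ((U⁻¹ : GL (Fin 2) E) : Matrix (Fin 2) (Fin 2) E) := fun g ↦ by
    simp [ψ, hΦdef, MulAut.conj_apply, Units.val_mul]
  have hψA : ∀ g, ((ψ g : GL (Fin 2) E) : Matrix (Fin 2) (Fin 2) E) = Qm * A g * Qi := by
    intro g
    rw [hψ, hUdef, _root_.mul_inv_rev, inv_inv, Units.val_mul, Units.val_mul, hPu]
    change Qm * _ * Φ g * (P * Qi) = Qm * A g * Qi
    simp only [hAdef, mul_assoc]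
  have hψentry : ∀ g i k, ((ψ g : GL (Fin 2) E) : Matrix (Fin 2) (Fin 2) E) i k =
      ![(1 : E), β] i * A g i k * ![(1 : E), β⁻¹] k := by
    intro g i k
    rw [hψA]
    simp only [Qm, Qi, Matrix.mul_diagonal, Matrix.diagonal_mul]
  have hψR : ∀ g i k, ((ψ g : GL (Fin 2) E) : Matrix (Fin 2) (Fin 2) E) i k ∈ R := by
    intro g
    rw [Fin.forall_fin_two, Fin.forall_fin_two, Fin.forall_fin_two]
    simp only [hψentry]
    refine ⟨⟨?_, ?_⟩, ?_, ?_⟩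
    · simpa [hadef] using haR g
    · -- `b g / β = (b g c' g₀) (β c' g₀)⁻¹`
      have h1 : ![(1 : E), β] 0 * A g 0 1 * ![(1 : E), β⁻¹] 1 = (b g * c' g₀) * (β * c' g₀)⁻¹ := by
        simp [hbdef]
        field_simp
      rw [h1]
      exact mul_mem (hbcR g g₀) (inv_mem (hbcR h₀ g₀))
    · simpa [hc'def, hβdef] using hbcR h₀ g
    · have h1 : ![(1 : E), β] 1 * A g 1 1 * ![(1 : E), β⁻¹] 1 = d g := by
        simp [hddef]
        field_simp
      rw [h1]
      exact hdR g
  -- ### the descended `ρ₀ : G → GL₂(F)`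
  obtain ⟨ρ₀, hρ₀⟩ := exists_glHom_lift j ψ fun g i k ↦ hmemR.mp (hψR g i k)
  -- continuity
  have hψcont : Continuous fun g ↦ ((ψ g : GL (Fin 2) E) : Matrix (Fin 2) (Fin 2) E) := by
    simp only [hψ]
    exact (continuous_const.mul hΦcont).mul continuous_const
  have hρ₀cont : Continuous ρ₀ := by
    refine Continuous.of_coeHom_comp ?_
    show Continuous fun g ↦ ((ρ₀ g : GL (Fin 2) F) : Matrix (Fin 2) (Fin 2) F)
    refine continuous_matrix fun i k ↦ ?_
    rw [hj.continuous_iff]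
    have h1 : (j ∘ fun g ↦ ((ρ₀ g : GL (Fin 2) F) : Matrix (Fin 2) (Fin 2) F) i k) =
        fun g ↦ ((ψ g : GL (Fin 2) E) : Matrix (Fin 2) (Fin 2) E) i k := by
      funext g
      simp only [Function.comp_apply, ← hρ₀ g, Matrix.map_apply]
    rw [h1]
    exact hψcont.matrix_elem i k
  -- ### conclusion
  set R₀ := (Representation.ofDistribMulAction F (GL (Fin 2) F) (Fin 2 → F)).comp ρ₀ with hR₀
  have hR₀apply : ∀ (g : G) (v : Fin 2 → F),
      R₀ g v = ((ρ₀ g : GL (Fin 2) F) : Matrix (Fin 2) (Fin 2) F) *ᵥ v := fun _ _ ↦ rfl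
  have hirr : Representation.IsIrreducible R₀ := by
    have hbot : (⊥ : Subrepresentation R₀).toSubmodule = ⊥ := rfl
    have htop : (⊤ : Subrepresentation R₀).toSubmodule = ⊤ := rfl
    have hbt : (⊥ : Subrepresentation R₀) ≠ ⊤ := by
      intro h
      have h' := congrArg Subrepresentation.toSubmodule h
      rw [hbot, htop] at h'
      exact bot_ne_top h'
    haveI : Nontrivial (Subrepresentation R₀) := ⟨⟨⊥, ⊤, hbt⟩⟩
    refine ⟨fun W ↦ ?_⟩
    by_contra hW
    rw [not_or] at hW
    obtain ⟨hW0, hW1⟩ := hW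
    have hW0' : W.toSubmodule ≠ ⊥ := fun h ↦ hW0 (Subrepresentation.toSubmodule_injective
      (by rw [h, hbot]))
    have hW1' : W.toSubmodule ≠ ⊤ := fun h ↦ hW1 (Subrepresentation.toSubmodule_injective
      (by rw [h, htop]))
    have hWrank : finrank F W.toSubmodule = 1 := finrank_eq_one_of_ne_bot_of_ne_top hW0' hW1'
    obtain ⟨w, hwW, hw0⟩ := Submodule.exists_mem_ne_zero_of_ne_bot hW0'
    have hmult : ∀ v ∈ W.toSubmodule, ∃ t : F, t • w = v := by
      intro v hv
      have h1 := (finrank_eq_one_iff_of_nonzero' (⟨w, hwW⟩ : W.toSubmodule)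
        (by exact_mod_cast Subtype.coe_ne_coe.mp hw0 : (⟨w, hwW⟩ : W.toSubmodule) ≠ 0)).mp
          hWrank ⟨v, hv⟩
      obtain ⟨t, ht⟩ := h1
      exact ⟨t, by simpa using congrArg Subtype.val ht⟩
    -- `j ∘ w` is a common eigenvector of `ψ`, hence `U⁻¹ (j ∘ w)` one of `φ`
    have hjw0 : (j ∘ w : Fin 2 → E) ≠ 0 := by
      intro h
      apply hw0
      funext i
      exact j.injective (by simpa using congr_fun h i)
    have heig : ∀ g, ∃ t : E, (((U : GL (Fin 2) E) : Matrix (Fin 2) (Fin 2) E) * Φ g *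
        ((U⁻¹ : GL (Fin 2) E) : Matrix (Fin 2) (Fin 2) E)) *ᵥ (j ∘ w) = t • (j ∘ w) := by
      intro g
      obtain ⟨t, ht⟩ := hmult _ (W.apply_mem_toSubmodule g hwW)
      refine ⟨j t, ?_⟩
      rw [← hψ, ← hρ₀]
      funext i
      rw [← RingHom.map_mulVec, ← hR₀apply, ← ht]
      simp
    obtain ⟨h0, h1⟩ := common_eigenvector_of_conj Φ U hjw0 heig
    exact hno' _ h0 h1
  refine ⟨⟨ρ₀, hρ₀cont⟩, ?_, fun g ↦ ?_, fun g hg ↦ ?_⟩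
  · haveI : IsSimpleOrder (Subrepresentation R₀) := hirr
    exact (inferInstance : ComplementedLattice (Subrepresentation R₀))
  · change (((ρ₀ g : GL (Fin 2) F) : Matrix (Fin 2) (Fin 2) F).map j).charpoly = (Φ g).charpoly
    rw [hρ₀, hψ, Matrix.coe_units_inv, Matrix.charpoly_units_conj]
  · change ρ₀ g = 1
    have h1 : ((ψ g : GL (Fin 2) E) : Matrix (Fin 2) (Fin 2) E) = 1 := by
      rw [hψ]
      simp [hΦdef, hg]
    apply Units.ext
    apply Matrix.map_injective j.injective
    change (((ρ₀ g : GL (Fin 2) F) : Matrix (Fin 2) (Fin 2) F)).map j = (1 : Matrix (Fin 2) (Fin 2) F).map j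
    rw [hρ₀, h1, Matrix.map_one _ (map_zero j) (map_one j)]

/-- **Descent of an odd two-dimensional representation to the field of its traces**
(Deligne–Serre 1974, footnote (2) p. 521; Ribet 1977, §2). Let `j : F → E` be a topological
embedding of fields with `2 ≠ 0`, `G` a topological group and `φ : G → GL₂(E)` a continuous
representation with `tr φ(g) ∈ j(F)` for all `g`, whose image contains an odd involution:
`φ(c)` with `c² = 1` and `det φ(c) = -1`. Then there is a continuous `ρ : G → GL₂(F)` whose
representation on `F²` is semisimple, with `det(X - ρ(g)) ↦ det(X - φ(g))` under `j` for every
`g` (same characteristic polynomials) and `ρ(g) = 1` whenever `φ(g) = 1` (so `ρ` is trivial on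
every subgroup on which `φ` is). (If `φ` is semisimple, `ρ ⊗_F E ≅ φ`, by Brauer–Nesbitt in
characteristic `0`; this is not needed here and not proved.)
[cite: DeligneSerreASENS1974, footnote (2) p. 521] -/
theorem exists_continuous_descent_fin_two_of_det_eq_neg_one (hj : IsInducing j)
    (φ : G →ₜ* GL (Fin 2) E) (h2 : (2 : E) ≠ 0)
    (htr : ∀ g, ((φ g : GL (Fin 2) E) : Matrix (Fin 2) (Fin 2) E).trace ∈ Set.range j)
    {c : G} (hc : c * c = 1) (hdet : ((φ c : GL (Fin 2) E) : Matrix (Fin 2) (Fin 2) E).det = -1) :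
    ∃ ρ : G →ₜ* GL (Fin 2) F,
      Representation.IsSemisimpleRepresentation
        ((Representation.ofDistribMulAction F (GL (Fin 2) F) (Fin 2 → F)).comp ρ.toMonoidHom) ∧
      (∀ g, (((ρ g : GL (Fin 2) F) : Matrix (Fin 2) (Fin 2) F).map j).charpoly =
        ((φ g : GL (Fin 2) E) : Matrix (Fin 2) (Fin 2) E).charpoly) ∧
      ∀ g, φ g = 1 → ρ g = 1 := by
  by_cases h : ∃ w : Fin 2 → E, w ≠ 0 ∧
      ∀ g, ∃ t : E, ((φ g : GL (Fin 2) E) : Matrix (Fin 2) (Fin 2) E) *ᵥ w = t • w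
  · obtain ⟨w, hw, heig⟩ := h
    exact exists_continuous_descent_fin_two_of_common_eigenvector j hj φ h2 htr hc hdet hw heig
  · exact exists_continuous_descent_fin_two_of_no_common_eigenvector j hj φ h2 htr hc hdet
      fun w hw hall ↦ h ⟨w, hw, hall⟩

end Irreducible

end Literature.RepresentationTheory.Semisimple
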